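import Summits.BirchSwinnertonDyer.BirchSwinnertonDyer.Theorems.KolyvaginRoadThreeSchneiderTamAtThreeHeightLogNumeratorExactPCertSplitCore
import HarnessLib

/-!
# «The height is the logarithm of the numerator» — part 11c: THE REGIME-FREE SPLIT ROW CHECKER at `p ≥ 5`
# (`RegMult.CertSplit W p Q 1` from an approximate Tate parameter `q̃`; any `ν`, any level `k`)

HONEST FRAMING (cell `bsd-stepL`, seat `bsd-stepL-tam3-p2` g5, WIDTH-LEVER second lane «closed-form Schneider local factor …
from the Tate/formal-group parametrisation»; `--supports stmt-BirchSwinnertonDyer-19154 --as helper`): THEOREMS ONLY; 0 definitions,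
0 named facts, 0 sorry; ONE curve per application; nothing class-wide; Schneider's conjecture and BSD asserted nowhere. Route-free.

Part 8c's split checker reads `C⁻²`, `κ_E`, `log_p q_E` from the first `q`-digits and therefore needs `k + v_L ≤ ν` — which EXCLUDES
every split pair with `ν = v_p(Δ) = 1` (e.g. TR7 of crux 19624) or `ν = 2 < k + v_L` (TR8). Here the three constants are read off an
integer `q̃ = p^ν·u ≡ q_E (mod p^m)` CERTIFIED by part 10 (`p^m ∣ Δ·Ẽ₄³ − q̃·Π̃·c₄³`, one finite evaluation of the truncated `E₄` and
`∏(1−qⁿ)²⁴` at `q̃`), through part 11a (`C⁻² = −E₄c₆/(E₆c₄)` exactly; `s_k` Lipschitz; `log_p q_E = log_p u + O(p^{−(m−ν)})`) and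
part 11b (reduced truncated logarithms; the abstract split assembly). Precision bookkeeping: `m ≥ 2k + 2v + ν`,
`ν(M+1) ≥ 2k + v`, `ν(M+2) ≥ m`, `v = v_p(log_p u) ≤ 2k` (`p^v ∥ B`, `B ≡ u^{p−1} − 1 (mod p^{2k+2v})`). The rational compared with
`ĥ^{split}(Q)` at precision `p^{−4k}` is `T_s = M_s/Den`, `Den = 720(p−1)·L·c₄·Ẽ₆·a³·S_B`,
`M_s = 720·S_L·c₄Ẽ₆a³S_B + 60(Ẽ₄c₆Ẽ₂ + b₂c₄Ẽ₆)E(p−1)La²S_B + c₆Ẽ₄(720a²E − 60b₂aE² + (5b₂²+3c₄)E³)(p−1)²L·L_B` (`E = (pᵏe')²`;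
`T_s = (p−1)⁻¹S_L/L − κ̃·x⁻¹ − c̃P₃(x⁻¹)/ℓ̃og`, `κ̃ = (c̃Ẽ₂ − b₂)/12`, `c̃ = −Ẽ₄c₆/(Ẽ₆c₄)`, `ℓ̃og = (p−1)⁻¹S_B/L_B`):
**`p^{4k+d} ∤ M_s` (`p^d ∥ Den`) certifies `ĥ^{split}(Q) ≠ 0`**, i.e. `RegMult.CertSplit W p Q 1`. Every hypothesis is decided by
`norm_num`/`decide` on integers (`σ_k(n)` of `n ≤ M` included).
References: [SteinWuthrich2013] §4.2; [SilvermanATAEC1994] V.3.1 (b), V.5.1; [SilvermanAEC2009] VII.2.1; [Iwasawa1972PadicL] §4.4;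
tree: parts 6, 8b, 8c, 10, 11a, 11b.
-/

noncomputable section

open scoped Classical
open scoped ArithmeticFunction.sigma
open IsUltrametricDist
open WeierstrassCurve Literature.NumberTheory.EllipticCurves
open Literature.NumberTheory.EllipticCurves.SteinWuthrich2013
open Literature.NumberTheory.EllipticCurves.TateCurve
open Literature.NumberTheory.EllipticCurves.Rank1Residual
open Summit.BirchSwinnertonDyer.Uniform.UI.O2
open Summit.BirchSwinnertonDyer.Rank1Residual Summit.BirchSwinnertonDyer.Rank1Residual.X11b
open Summit.BirchSwinnertonDyer.BirchSwinnertonDyer.Rank1Residual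

namespace Summit.BirchSwinnertonDyer.Rank1Residual.X11b.RegMult.HeightLogNumerator

variable {p : ℕ} [hp : Fact p.Prime]

section CertSplitChecker

set_option maxHeartbeats 3200000 in
/-- **THE REGIME-FREE SPLIT ROW CHECKER at `p ≥ 5` (value form).** `H₁`: the (4.1) data of the point (level `k`, reduced
logarithm argument `A ≡ a^{p−1} − 1 (mod p^{4k})`, `S_L`); `H₂`: the certified approximate Tate parameter `q̃ = p^ν u` with its
truncated `Ẽ₄, Ẽ₆, Ẽ₂, Π̃` (order `M`) and the precision inequalities; `H₃`: the reduced logarithm of `u` (`B`, `S_B`), `Den`, `M_s`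
and **`p^{4k+d} ∤ M_s`**. Conclusion: `heightSplitCoord W p q x y ≠ 0` for THE Tate parameter. ONE curve per application.
[cite: SteinWuthrich2013, §4.2] [cite: SilvermanATAEC1994, Lemma V.5.1] [cite: Iwasawa1972PadicL, §4.4] -/
theorem heightSplitCoord_ne_zero_of_certSplitRow_padic (hp5 : 5 ≤ p) (W : WeierstrassCurve ℚ) {a₁ a₂ a₃ a₄ a₆ : ℤ}
    (hW : W = ⟨a₁, a₂, a₃, a₄, a₆⟩) [W.IsElliptic] [W.IsGloballyMinimal] (hWm : Mult W p)
    {a c4 c6 D A SL L b2 qt u E4c E6c E2c Pic B SB LB Den Ms : ℤ} {e' k N α w ν M m v N' d : ℕ}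
    (H₁ : ¬ p ∣ e' ∧ 1 ≤ k ∧ Nat.Coprime a.natAbs (p ^ k * e') ∧
      c4 = (a₁ ^ 2 + 4 * a₂) ^ 2 - 24 * (2 * a₄ + a₁ * a₃) ∧
      c6 = -(a₁ ^ 2 + 4 * a₂) ^ 3 + 36 * (a₁ ^ 2 + 4 * a₂) * (2 * a₄ + a₁ * a₃) - 216 * (a₃ ^ 2 + 4 * a₆) ∧
      D = -(a₁ ^ 2 + 4 * a₂) ^ 2 * (a₁ ^ 2 * a₆ + 4 * a₂ * a₆ - a₁ * a₃ * a₄ + a₂ * a₃ ^ 2 - a₄ ^ 2) -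
        8 * (2 * a₄ + a₁ * a₃) ^ 3 - 27 * (a₃ ^ 2 + 4 * a₆) ^ 2 +
        9 * (a₁ ^ 2 + 4 * a₂) * (2 * a₄ + a₁ * a₃) * (a₃ ^ 2 + 4 * a₆) ∧
      ¬ (p : ℤ) ∣ c4 ∧
      (p : ℤ) ^ (4 * k) ∣ a ^ (p - 1) - 1 - A ∧ (p : ℤ) ^ α ∣ A ∧ 1 ≤ α ∧ (N + 1) * p ^ (4 * k) ≤ p ^ ((N + 1) * α) ∧
      (p : ℤ) ^ w ∣ L ∧ ¬ (p : ℤ) ^ (w + 1) ∣ L)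
    (hSL : (SL : ℚ) = L * ∑ n ∈ Finset.range N, (-1) ^ n * (A : ℚ) ^ (n + 1) / ((n : ℚ) + 1))
    (H₂ : b2 = a₁ ^ 2 + 4 * a₂ ∧ qt = (p : ℤ) ^ ν * u ∧ ¬ (p : ℤ) ∣ u ∧ 1 ≤ ν ∧
      E4c = 1 + 240 * ∑ n ∈ Finset.range M, (σ 3 (n + 1) : ℤ) * qt ^ (n + 1) ∧
      E6c = 1 - 504 * ∑ n ∈ Finset.range M, (σ 5 (n + 1) : ℤ) * qt ^ (n + 1) ∧
      E2c = 1 - 24 * ∑ n ∈ Finset.range M, (σ 1 (n + 1) : ℤ) * qt ^ (n + 1) ∧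
      Pic = ∏ n ∈ Finset.range M, (1 - qt ^ (n + 1)) ^ 24 ∧ ¬ (p : ℤ) ∣ E4c ∧ ¬ (p : ℤ) ∣ E6c ∧
      (p : ℤ) ^ m ∣ D * E4c ^ 3 - qt * Pic * c4 ^ 3 ∧ m ≤ ν * (M + 2) ∧ 2 * k + 2 * v + ν ≤ m ∧
      2 * k + v ≤ ν * (M + 1))
    (H₃ : (p : ℤ) ^ (2 * k + 2 * v) ∣ u ^ (p - 1) - 1 - B ∧ (p : ℤ) ^ v ∣ B ∧ ¬ (p : ℤ) ^ (v + 1) ∣ B ∧ 1 ≤ v ∧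
      v ≤ 2 * k ∧ (N' + 1) * p ^ (2 * k + 2 * v) ≤ p ^ ((N' + 1) * v) ∧
      Den = 720 * (p - 1 : ℕ) * L * c4 * E6c * a ^ 3 * SB ∧ (p : ℤ) ^ d ∣ Den ∧ ¬ (p : ℤ) ^ (d + 1) ∣ Den ∧
      Ms = 720 * SL * c4 * E6c * a ^ 3 * SB +
        60 * (E4c * c6 * E2c + b2 * c4 * E6c) * ((p ^ k * e' : ℕ) : ℤ) ^ 2 * (p - 1 : ℕ) * L * a ^ 2 * SB +
        c6 * E4c * (720 * a ^ 2 * ((p ^ k * e' : ℕ) : ℤ) ^ 2 - 60 * b2 * a * ((p ^ k * e' : ℕ) : ℤ) ^ 4 +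
          (5 * b2 ^ 2 + 3 * c4) * ((p ^ k * e' : ℕ) : ℤ) ^ 6) * (p - 1 : ℕ) ^ 2 * L * LB ∧
      ¬ (p : ℤ) ^ (4 * k + d) ∣ Ms)
    (hSB : (SB : ℚ) = LB * ∑ n ∈ Finset.range N', (-1) ^ n * (B : ℚ) ^ (n + 1) / ((n : ℚ) + 1))
    {x y : ℚ} (hx : x = a / ((p ^ k * e' : ℕ) : ℚ) ^ 2) (hP : W.toAffine.Equation x y)
    {q : ℚ_[p]} (hq : ‖q‖ < 1) (hj : tateJ q = (W.j : ℚ_[p])) :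
    heightSplitCoord W p q x y ≠ 0 := by
  obtain ⟨hpe', hk, hcop, hc4, hc6, hD, hpc4, hA, hαA, hα1, hNα, hwL, hwL'⟩ := H₁
  obtain ⟨hb2, hqt, hpu, hν1, hE4c, hE6c, hE2c, hPic, hpE4c, hpE6c, hcert, hmM, hmk, hkM⟩ := H₂
  obtain ⟨hB, hvB, hvB', hv1, hv2k, hN'v, hDen, hdD, hdD', hMs, hcrit⟩ := H₃
  have hpP : p.Prime := Fact.out
  have hp2 : p ≠ 2 := by omega
  have hp1 : (1 : ℝ) < p := by exact_mod_cast hpP.one_lt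
  have hp1' : (1 : ℝ) ≤ p := hp1.le
  have hpR0 : (0 : ℝ) < p := by positivity
  -- the point
  have he'0 : e' ≠ 0 := by rintro rfl; exact hpe' (dvd_zero p)
  have he0 : (p ^ k * e' : ℕ) ≠ 0 := Nat.mul_ne_zero (pow_ne_zero _ hpP.ne_zero) he'0
  have hpe : p ∣ p ^ k * e' := dvd_mul_of_dvd_left (dvd_pow_self p (by omega)) _
  have h : W.toAffine.Nonsingular x y :=
    (WeierstrassCurve.Affine.equation_iff_nonsingular (W := W.toAffine)).mp hP
  have hx1 : 1 < ‖(x : ℚ_[p])‖ :=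
    (one_lt_norm_ratCast_iff p x).mpr (KernelCert.padicValRat_x_neg he0 hx hcop hpe)
  have hpa : ¬ (p : ℤ) ∣ a := by
    intro hd
    have h1' : p ∣ a.natAbs := Int.natCast_dvd.mp hd
    have h2' : p ∣ Nat.gcd a.natAbs (p ^ k * e') := Nat.dvd_gcd h1' hpe
    rw [hcop] at h2'
    exact hpP.one_lt.ne' (Nat.dvd_one.mp h2')
  have han : ‖(a : ℚ_[p])‖ = 1 := BinaryQuartic.norm_intCast_eq_one hpa
  have ha0 : (a : ℚ_[p]) ≠ 0 := norm_pos_iff.mp (by rw [han]; exact one_pos)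
  have hc4n : ‖(c4 : ℚ_[p])‖ = 1 := BinaryQuartic.norm_intCast_eq_one hpc4
  have hc40 : (c4 : ℚ_[p]) ≠ 0 := norm_pos_iff.mp (by rw [hc4n]; exact one_pos)
  have hc6int : ‖(c6 : ℚ_[p])‖ ≤ 1 := Padic.norm_int_le_one _
  have hE4cn : ‖(E4c : ℚ_[p])‖ = 1 := BinaryQuartic.norm_intCast_eq_one hpE4c
  have hE6cn : ‖(E6c : ℚ_[p])‖ = 1 := BinaryQuartic.norm_intCast_eq_one hpE6c
  have hE6c0 : (E6c : ℚ_[p]) ≠ 0 := norm_pos_iff.mp (by rw [hE6cn]; exact one_pos)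
  have hE4c0 : (E4c : ℚ_[p]) ≠ 0 := norm_pos_iff.mp (by rw [hE4cn]; exact one_pos)
  have hLn : ‖(L : ℚ_[p])‖ = (p : ℝ) ^ (-(w : ℤ)) := GaloisImage.PadicSquareClass.norm_intCast_padic_eq hwL hwL'
  have hL0 : (L : ℚ_[p]) ≠ 0 := norm_pos_iff.mp (by rw [hLn]; positivity)
  have hp1n : ‖((p : ℚ_[p]) - 1)‖ = 1 := by
    rw [show (p : ℚ_[p]) - 1 = ((p - 1 : ℕ) : ℚ_[p]) by rw [Nat.cast_sub hpP.one_le, Nat.cast_one]]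
    exact Padic.norm_natCast_eq_one_iff.mpr ((Nat.coprime_self_sub_right hpP.one_le).mpr (Nat.coprime_one_right _))
  have hp10 : (p : ℚ_[p]) - 1 ≠ 0 := norm_pos_iff.mp (by rw [hp1n]; exact one_pos)
  have hp1i : ‖((p : ℚ_[p]) - 1)⁻¹‖ = 1 := by rw [norm_inv, hp1n, inv_one]
  set e : ℕ := p ^ k * e' with hedef
  have hcop2 : Nat.Coprime a.natAbs (((e : ℤ) ^ 2).natAbs) := by
    rw [Int.natAbs_pow, Int.natAbs_natCast]; exact hcop.pow_right 2
  have he2pos : (0 : ℤ) < (e : ℤ) ^ 2 := by positivity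
  have hxq : x = ((a : ℤ) : ℚ) / (((e : ℤ) ^ 2 : ℤ) : ℚ) := by rw [hx]; push_cast; ring
  have hnum : x.num = a := by rw [hxq]; exact Rat.num_div_eq_of_coprime he2pos hcop2
  have he'n : ‖(e' : ℚ_[p])‖ = 1 := by
    rw [show (e' : ℚ_[p]) = ((e' : ℤ) : ℚ_[p]) by norm_cast]
    exact BinaryQuartic.norm_intCast_eq_one (fun hd => hpe' (by exact_mod_cast hd))
  have he'0Q : (e' : ℚ_[p]) ≠ 0 := by exact_mod_cast he'0
  have hpQ : (p : ℚ_[p]) ≠ 0 := by exact_mod_cast hpP.ne_zero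
  have hxp : (x : ℚ_[p]) = (a : ℚ_[p]) / ((p : ℚ_[p]) ^ k * (e' : ℚ_[p])) ^ 2 := by
    rw [hx, hedef]; push_cast; ring
  have hxinv : ‖(x : ℚ_[p])‖⁻¹ = (p : ℝ) ^ (-((2 * k : ℕ) : ℤ)) := by
    rw [hxp, norm_div, han, norm_pow, norm_mul, norm_pow, Padic.norm_p, he'n,
      mul_one, one_div, inv_inv, ← zpow_natCast, ← zpow_natCast, ← zpow_mul, inv_zpow']
    congr 1; push_cast; ring
  have hX0 : (x : ℚ_[p]) ≠ 0 := norm_pos_iff.mp (one_pos.trans hx1)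
  have hdn : (((x.den : ℚ) : ℚ_[p])) / (((x.num : ℚ) : ℚ_[p])) = ((x : ℚ_[p]))⁻¹ := by
    have hd0 : ((x.den : ℚ) : ℚ_[p]) ≠ 0 := by exact_mod_cast x.den_nz
    have hnd : ((x.num : ℚ) : ℚ_[p]) = (x : ℚ_[p]) * ((x.den : ℚ) : ℚ_[p]) := by
      rw [← Rat.cast_mul, Rat.mul_den_eq_num]
    rw [hnd]; field_simp
  -- the curve data in `ℚ_p`
  set V := W.baseChange ℚ_[p] with hVdef
  have hVb2 : V.b₂ = (b2 : ℚ_[p]) := by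
    have h1 : V.b₂ = ((W.b₂ : ℚ) : ℚ_[p]) := (map_b₂ W (algebraMap ℚ ℚ_[p])).trans (eq_ratCast _ _)
    rw [h1, hb2]; subst hW; simp only [WeierstrassCurve.b₂]; push_cast; ring
  have hWc4Q : W.c₄ = (c4 : ℚ) := by
    subst hW; rw [hc4]; simp only [WeierstrassCurve.c₄, WeierstrassCurve.b₂, WeierstrassCurve.b₄]; push_cast; ring
  have hWc6Q : W.c₆ = (c6 : ℚ) := by
    subst hW; rw [hc6]
    simp only [WeierstrassCurve.c₆, WeierstrassCurve.b₂, WeierstrassCurve.b₄, WeierstrassCurve.b₆]; push_cast; ring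
  have hVc4 : V.c₄ = (c4 : ℚ_[p]) := by
    have h1 : V.c₄ = ((W.c₄ : ℚ) : ℚ_[p]) := (map_c₄ W (algebraMap ℚ ℚ_[p])).trans (eq_ratCast _ _)
    rw [h1, hWc4Q]; push_cast; rfl
  have hVc6 : V.c₆ = (c6 : ℚ_[p]) := by
    have h1 : V.c₆ = ((W.c₆ : ℚ) : ℚ_[p]) := (map_c₆ W (algebraMap ℚ ℚ_[p])).trans (eq_ratCast _ _)
    rw [h1, hWc6Q]; push_cast; rfl
  have hjinv : ((W.j : ℚ_[p]))⁻¹ = (D : ℚ_[p]) / (c4 : ℚ_[p]) ^ 3 := ratCast_j_inv_eq_padic (p := p) W hW hc4 hD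
  have hb2n : ‖V.b₂‖ ≤ 1 := by rw [hVb2]; exact Padic.norm_int_le_one _
  have hVc4n : ‖V.c₄‖ = 1 := by rw [hVc4]; exact hc4n
  -- (A) the approximate Tate parameter `q̃ = p^ν u`
  have hun : ‖(u : ℚ_[p])‖ = 1 := BinaryQuartic.norm_intCast_eq_one hpu
  have hu0 : (u : ℚ_[p]) ≠ 0 := norm_pos_iff.mp (by rw [hun]; exact one_pos)
  have hqtu : (qt : ℚ_[p]) = (p : ℚ_[p]) ^ ν * (u : ℚ_[p]) := by rw [hqt]; push_cast; ring
  have hqtn : ‖(qt : ℚ_[p])‖ = (p : ℝ) ^ (-(ν : ℤ)) := by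
    rw [hqtu, norm_mul, norm_pow, Padic.norm_p, hun, mul_one, ← zpow_natCast, inv_zpow']
  have hqt1 : ‖(qt : ℚ_[p])‖ < 1 := by rw [hqtn]; exact zpow_lt_one_of_neg₀ hp1 (by omega)
  have hqt0 : (qt : ℚ_[p]) ≠ 0 := norm_pos_iff.mp (by rw [hqtn]; positivity)
  -- (B) `‖q − q̃‖ ≤ p^{−m}` (part 10 certificate)
  have hE4cQ : (E4c : ℚ_[p]) = 1 + 240 * ∑ n ∈ Finset.range M, ((σ 3 (n + 1) : ℕ) : ℚ_[p]) * (qt : ℚ_[p]) ^ (n + 1) := by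
    rw [hE4c]; push_cast; rfl
  have hE6cQ : (E6c : ℚ_[p]) = 1 - 504 * ∑ n ∈ Finset.range M, ((σ 5 (n + 1) : ℕ) : ℚ_[p]) * (qt : ℚ_[p]) ^ (n + 1) := by
    rw [hE6c]; push_cast; rfl
  have hE2cQ : (E2c : ℚ_[p]) = 1 - 24 * ∑ n ∈ Finset.range M, ((σ 1 (n + 1) : ℕ) : ℚ_[p]) * (qt : ℚ_[p]) ^ (n + 1) := by
    rw [hE2c]; push_cast; rfl
  have hPicQ : (Pic : ℚ_[p]) = ∏ n ∈ Finset.range M, (1 - (qt : ℚ_[p]) ^ (n + 1)) ^ 24 := by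
    rw [hPic]; push_cast; rfl
  have hqq : ‖q - (qt : ℚ_[p])‖ ≤ (p : ℝ) ^ (-(m : ℤ)) := by
    have hc := norm_tateParam_sub_le_of_cert M hq hj hqt1
    rw [← hPicQ, ← hE4cQ, hjinv] at hc
    refine hc.trans (max_le ?_ ?_)
    · rw [show (D : ℚ_[p]) / (c4 : ℚ_[p]) ^ 3 - (qt : ℚ_[p]) * (Pic : ℚ_[p]) / (E4c : ℚ_[p]) ^ 3 =
          ((D * E4c ^ 3 - qt * Pic * c4 ^ 3 : ℤ) : ℚ_[p]) / ((c4 : ℚ_[p]) ^ 3 * (E4c : ℚ_[p]) ^ 3) by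
            push_cast; field_simp,
        norm_div, norm_mul, norm_pow, norm_pow, hc4n, hE4cn, one_pow, mul_one, div_one]
      exact_mod_cast (Padic.norm_int_le_pow_iff_dvd (D * E4c ^ 3 - qt * Pic * c4 ^ 3) m).mpr hcert
    · rw [hqtn, ← zpow_natCast, ← zpow_mul]
      exact zpow_le_zpow_right₀ hp1' (by push_cast; nlinarith)
  -- (C) the Eisenstein values at `q` from the truncations at `q̃`; `ε = p^{−(2k+v)}`
  have hnear : max ‖q - (qt : ℚ_[p])‖ (‖(qt : ℚ_[p])‖ ^ (M + 1)) ≤ (p : ℝ) ^ (-((2 * k + v : ℕ) : ℤ)) := by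
    refine max_le (hqq.trans (zpow_le_zpow_right₀ hp1' (by push_cast; omega))) ?_
    rw [hqtn, ← zpow_natCast, ← zpow_mul]
    exact zpow_le_zpow_right₀ hp1' (by push_cast; nlinarith)
  have hsmall : ∀ (c : ℤ) (kk : ℕ), ‖(c : ℚ_[p]) * (tateS kk q -
      ∑ n ∈ Finset.range M, ((σ kk (n + 1) : ℕ) : ℚ_[p]) * (qt : ℚ_[p]) ^ (n + 1))‖ ≤ (p : ℝ) ^ (-((2 * k + v : ℕ) : ℤ)) := by
    intro c kk
    rw [norm_mul]
    calc ‖(c : ℚ_[p])‖ * _ ≤ 1 * (p : ℝ) ^ (-((2 * k + v : ℕ) : ℤ)) :=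
          mul_le_mul (Padic.norm_int_le_one _) ((norm_tateS_sub_sum_le_of_near kk M hq hqt1).trans hnear)
            (norm_nonneg _) zero_le_one
      _ = _ := one_mul _
  have h4 : ‖tateE4 q - (E4c : ℚ_[p])‖ ≤ (p : ℝ) ^ (-((2 * k + v : ℕ) : ℤ)) := by
    rw [hE4cQ, tateE4_eq, show (1 : ℚ_[p]) + 240 * tateS 3 q -
        (1 + 240 * ∑ n ∈ Finset.range M, ((σ 3 (n + 1) : ℕ) : ℚ_[p]) * (qt : ℚ_[p]) ^ (n + 1)) =
        ((240 : ℤ) : ℚ_[p]) * (tateS 3 q - ∑ n ∈ Finset.range M, ((σ 3 (n + 1) : ℕ) : ℚ_[p]) * (qt : ℚ_[p]) ^ (n + 1))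
        by push_cast; ring]
    exact hsmall 240 3
  have h6 : ‖tateE6 q - (E6c : ℚ_[p])‖ ≤ (p : ℝ) ^ (-((2 * k + v : ℕ) : ℤ)) := by
    rw [hE6cQ, tateE6, show (1 : ℚ_[p]) - 504 * tateS 5 q -
        (1 - 504 * ∑ n ∈ Finset.range M, ((σ 5 (n + 1) : ℕ) : ℚ_[p]) * (qt : ℚ_[p]) ^ (n + 1)) =
        ((-504 : ℤ) : ℚ_[p]) * (tateS 5 q - ∑ n ∈ Finset.range M, ((σ 5 (n + 1) : ℕ) : ℚ_[p]) * (qt : ℚ_[p]) ^ (n + 1))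
        by push_cast; ring]
    exact hsmall (-504) 5
  have h2 : ‖((1 : ℚ_[p]) - 24 * tateS 1 q) - (E2c : ℚ_[p])‖ ≤ (p : ℝ) ^ (-((2 * k + v : ℕ) : ℤ)) := by
    rw [hE2cQ, show (1 : ℚ_[p]) - 24 * tateS 1 q -
        (1 - 24 * ∑ n ∈ Finset.range M, ((σ 1 (n + 1) : ℕ) : ℚ_[p]) * (qt : ℚ_[p]) ^ (n + 1)) =
        ((-24 : ℤ) : ℚ_[p]) * (tateS 1 q - ∑ n ∈ Finset.range M, ((σ 1 (n + 1) : ℕ) : ℚ_[p]) * (qt : ℚ_[p]) ^ (n + 1))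
        by push_cast; ring]
    exact hsmall (-24) 1
  -- (D) `C⁻²` and `κ`
  have hε1 : (p : ℝ) ^ (-((2 * k + v : ℕ) : ℤ)) < 1 := zpow_lt_one_of_neg₀ hp1 (by push_cast; omega)
  set ct : ℚ_[p] := -((E4c : ℚ_[p]) * V.c₆) / ((E6c : ℚ_[p]) * V.c₄) with hctdef
  have hCct : ‖(uniformisationScaleSq W p q)⁻¹ - ct‖ ≤ (p : ℝ) ^ (-((2 * k + v : ℕ) : ℤ)) :=
    norm_inv_uniformisationScaleSq_sub_cert_le_padic hWm hq h4 h6 hε1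
  have hctn : ‖ct‖ ≤ 1 := by
    rw [hctdef, norm_div, norm_neg, norm_mul, norm_mul, hE4cn, hE6cn, hVc4n, hVc6, one_mul, one_mul, div_one]
    exact hc6int
  have hκ := norm_kappaE_sub_cert_le_padic hp5 W hq hCct hctn h2
  rw [← hVdef] at hκ
  -- (E) the logarithms: `lg = (p−1)⁻¹·S_B/L_B ≈ log_p u = log_p q̃ ≈ log_p q`
  have hBn : ‖(B : ℚ_[p])‖ = (p : ℝ) ^ (-(v : ℤ)) := GaloisImage.PadicSquareClass.norm_intCast_padic_eq hvB hvB'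
  have hBp : ‖(B : ℚ_[p])‖ ≤ (p : ℝ)⁻¹ := by
    rw [hBn, ← zpow_neg_one]; exact zpow_le_zpow_right₀ hp1' (by omega)
  have h22 : ((p : ℝ) ^ (-((2 * k + 2 * v : ℕ) : ℤ))) < (p : ℝ) ^ (-(v : ℤ)) :=
    zpow_lt_zpow_right₀ hp1 (by push_cast; omega)
  have hrem : ((N' : ℝ) + 1) * ‖(B : ℚ_[p])‖ ^ (N' + 1) ≤ (p : ℝ) ^ (-((2 * k + 2 * v : ℕ) : ℤ)) := by
    have key : ((N' : ℝ) + 1) * ((p : ℝ) ^ ((N' + 1) * v))⁻¹ ≤ ((p : ℝ) ^ (2 * k + 2 * v))⁻¹ := by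
      rw [mul_inv_le_iff₀ (by positivity), inv_mul_eq_div, le_div_iff₀ (by positivity)]
      exact_mod_cast hN'v
    calc ((N' : ℝ) + 1) * ‖(B : ℚ_[p])‖ ^ (N' + 1) = ((N' : ℝ) + 1) * ((p : ℝ) ^ (-(v : ℤ))) ^ (N' + 1) := by rw [hBn]
      _ = ((N' : ℝ) + 1) * ((p : ℝ) ^ ((N' + 1) * v))⁻¹ := by
          rw [zpow_neg, zpow_natCast, inv_pow, ← pow_mul, mul_comm v]
      _ ≤ ((p : ℝ) ^ (2 * k + 2 * v))⁻¹ := key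
      _ = (p : ℝ) ^ (-((2 * k + 2 * v : ℕ) : ℤ)) := by rw [zpow_neg, zpow_natCast]
  have hSBp : ∑ n ∈ Finset.range N', (-1) ^ n * ((B : ℚ_[p])) ^ (n + 1) / ((n : ℚ_[p]) + 1) =
      (SB : ℚ_[p]) / (LB : ℚ_[p]) := by
    have hc := congrArg (fun t : ℚ => (t : ℚ_[p])) hSB
    have hc' : ((SB : ℚ_[p])) = (LB : ℚ_[p]) *
        ∑ n ∈ Finset.range N', (-1) ^ n * ((B : ℚ_[p])) ^ (n + 1) / ((n : ℚ_[p]) + 1) := by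
      simpa [Rat.cast_sum] using hc
    -- `LB ≠ 0`: otherwise `SB = 0`, `Den = 0`, contradicting `p^{d+1} ∤ Den`
    have hLB0 : (LB : ℚ_[p]) ≠ 0 := by
      intro h0
      have hSB0 : (SB : ℚ_[p]) = 0 := by rw [hc', h0, zero_mul]
      have hSBZ : SB = 0 := by exact_mod_cast hSB0
      apply hdD'; rw [hDen, hSBZ]; simp
    rw [hc']; field_simp
  have hlogu := norm_padicLog_intCast_sub_truncRed_le_padic (p := p) hp2 N' hpu hB hvB hv1
  rw [hSBp] at hlogu
  set lg : ℚ_[p] := ((p : ℚ_[p]) - 1)⁻¹ * ((SB : ℚ_[p]) / (LB : ℚ_[p])) with hlgdef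
  have hlogu' : ‖padicLog p (u : ℚ_[p]) - lg‖ ≤ (p : ℝ) ^ (-((2 * k + 2 * v : ℕ) : ℤ)) :=
    hlogu.trans (max_le (by push_cast; exact le_rfl) hrem)
  -- `‖lg‖ = p^{−v}`: `S_B/L_B = log_p(1+B) − R`, `‖R‖ ≤ p^{−(2k+2v)} < p^{−v} = ‖log_p(1+B)‖`
  have hlgn : ‖lg‖ = (p : ℝ) ^ (-(v : ℤ)) := by
    have htr := norm_padicLog_one_add_sub_sum_le_padic N' hBp
    rw [hSBp] at htr
    have hl1 : ‖padicLog p (1 + (B : ℚ_[p]))‖ = (p : ℝ) ^ (-(v : ℤ)) := by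
      rw [norm_padicLog_one_add_eq_padic hp2 hBp, hBn]
    have hlt : ‖padicLog p (1 + (B : ℚ_[p])) - (SB : ℚ_[p]) / (LB : ℚ_[p])‖ < ‖padicLog p (1 + (B : ℚ_[p]))‖ := by
      rw [hl1]; exact (htr.trans hrem).trans_lt h22
    have hs : ‖(SB : ℚ_[p]) / (LB : ℚ_[p])‖ = (p : ℝ) ^ (-(v : ℤ)) := by
      rw [← hl1, show (SB : ℚ_[p]) / (LB : ℚ_[p]) = padicLog p (1 + (B : ℚ_[p])) +
          -(padicLog p (1 + (B : ℚ_[p])) - (SB : ℚ_[p]) / (LB : ℚ_[p])) by ring,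
        norm_add_eq_max_of_norm_ne_norm (by rw [norm_neg]; exact hlt.ne'), norm_neg, max_eq_left hlt.le]
    rw [hlgdef, norm_mul, hp1i, one_mul, hs]
  have hloguN : ‖padicLog p (u : ℚ_[p])‖ = (p : ℝ) ^ (-(v : ℤ)) := by
    have hlt : ‖padicLog p (u : ℚ_[p]) - lg‖ < ‖lg‖ := by rw [hlgn]; exact hlogu'.trans_lt h22
    rw [← hlgn, show padicLog p (u : ℚ_[p]) = lg + (padicLog p (u : ℚ_[p]) - lg) by ring,
      norm_add_eq_max_of_norm_ne_norm hlt.ne', max_eq_left hlt.le]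
  -- `log_p q̃ = log_p u` and `‖log_p q − log_p q̃‖ ≤ p^{ν−m} ≤ p^{−(2k+2v)}`
  have hlogqt : padicLog p (qt : ℚ_[p]) = padicLog p (u : ℚ_[p]) := by rw [hqtu]; exact padicLog_pow_p_mul_padic ν hu0
  have hqq' : ‖q - (qt : ℚ_[p])‖ ≤ (p : ℝ)⁻¹ * ‖(qt : ℚ_[p])‖ := by
    rw [hqtn, ← zpow_neg_one, ← zpow_add₀ hpR0.ne']
    exact hqq.trans (zpow_le_zpow_right₀ hp1' (by omega))
  have hlogq : ‖padicLog p q - padicLog p (u : ℚ_[p])‖ ≤ (p : ℝ) ^ (-((2 * k + 2 * v : ℕ) : ℤ)) := by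
    rw [← hlogqt]
    refine (norm_padicLog_sub_padicLog_le_padic hqt0 hqq').trans ?_
    rw [hqtn, div_le_iff₀ (by positivity), ← zpow_add₀ hpR0.ne']
    exact hqq.trans (zpow_le_zpow_right₀ hp1' (by push_cast; omega))
  have hLq : ‖padicLog p q‖ = (p : ℝ) ^ (-(v : ℤ)) := by
    have hlt : ‖padicLog p q - padicLog p (u : ℚ_[p])‖ < ‖padicLog p (u : ℚ_[p])‖ := by
      rw [hloguN]; exact hlogq.trans_lt h22
    rw [← hloguN, show padicLog p q = padicLog p (u : ℚ_[p]) + (padicLog p q - padicLog p (u : ℚ_[p])) by ring,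
      norm_add_eq_max_of_norm_ne_norm hlt.ne', max_eq_left hlt.le]
  have hLl : ‖padicLog p q - lg‖ ≤ (p : ℝ) ^ (-((2 * k + 2 * v : ℕ) : ℤ)) := by
    rw [show padicLog p q - lg = (padicLog p q - padicLog p (u : ℚ_[p])) + (padicLog p (u : ℚ_[p]) - lg) by ring]
    exact (norm_add_le_max _ _).trans (max_le hlogq hlogu')
  -- (F) the (4.1) part: `‖ĥ₄.₁ − T‖ ≤ p^{−4k}`, `T = (p−1)⁻¹ S_L/L + κ̃·x⁻¹`
  have hlaw := norm_heightFourOneCoord_sub_padicLog_num_add_kappaE_mul_le_padic hp5 hWm hq h hx1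
  rw [hdn, hxinv, ← hVdef] at hlaw
  have hloga := norm_padicLog_intCast_sub_truncRed_le_padic (p := p) hp2 N hpa hA hαA hα1
  have hAn : ‖(A : ℚ_[p])‖ ≤ (p : ℝ) ^ (-(α : ℤ)) := by exact_mod_cast (Padic.norm_int_le_pow_iff_dvd A α).mpr hαA
  have hSLp : ∑ n ∈ Finset.range N, (-1) ^ n * ((A : ℚ_[p])) ^ (n + 1) / ((n : ℚ_[p]) + 1) =
      (SL : ℚ_[p]) / (L : ℚ_[p]) := by
    have hc := congrArg (fun t : ℚ => (t : ℚ_[p])) hSL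
    have hc' : ((SL : ℚ_[p])) = (L : ℚ_[p]) *
        ∑ n ∈ Finset.range N, (-1) ^ n * ((A : ℚ_[p])) ^ (n + 1) / ((n : ℚ_[p]) + 1) := by
      simpa [Rat.cast_sum] using hc
    rw [hc']; field_simp
  rw [hSLp] at hloga
  have h4k : ((p : ℝ) ^ (-((2 * k : ℕ) : ℤ))) ^ 2 = (p : ℝ) ^ (-((4 * k : ℕ) : ℤ)) := by
    rw [← zpow_natCast, ← zpow_mul]; congr 1; push_cast; ring
  have hloga' : ‖padicLog p (a : ℚ_[p]) - ((p : ℚ_[p]) - 1)⁻¹ * ((SL : ℚ_[p]) / (L : ℚ_[p]))‖ ≤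
      (p : ℝ) ^ (-((4 * k : ℕ) : ℤ)) := by
    refine hloga.trans (max_le (by push_cast; exact le_rfl) ?_)
    have key : ((N : ℝ) + 1) * ((p : ℝ) ^ ((N + 1) * α))⁻¹ ≤ ((p : ℝ) ^ (4 * k))⁻¹ := by
      rw [mul_inv_le_iff₀ (by positivity), inv_mul_eq_div, le_div_iff₀ (by positivity)]
      exact_mod_cast hNα
    calc ((N : ℝ) + 1) * ‖(A : ℚ_[p])‖ ^ (N + 1) ≤ ((N : ℝ) + 1) * ((p : ℝ) ^ (-(α : ℤ))) ^ (N + 1) := by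
          gcongr
      _ = ((N : ℝ) + 1) * ((p : ℝ) ^ ((N + 1) * α))⁻¹ := by
          rw [zpow_neg, zpow_natCast, inv_pow, ← pow_mul, mul_comm α]
      _ ≤ ((p : ℝ) ^ (4 * k))⁻¹ := key
      _ = (p : ℝ) ^ (-((4 * k : ℕ) : ℤ)) := by rw [zpow_neg, zpow_natCast]
  set κt : ℚ_[p] := (ct * (E2c : ℚ_[p]) - V.b₂) / 12 with hκtdef
  set T : ℚ_[p] := ((p : ℚ_[p]) - 1)⁻¹ * ((SL : ℚ_[p]) / (L : ℚ_[p])) - κt * ((x : ℚ_[p]))⁻¹ with hTdef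
  have hT : ‖heightFourOneCoord W p q x y - T‖ ≤ (p : ℝ) ^ (-((4 * k : ℕ) : ℤ)) := by
    have e1 : heightFourOneCoord W p q x y - T =
        (heightFourOneCoord W p q x y - padicLog p ((x.num : ℚ) : ℚ_[p]) +
          ((uniformisationScaleSq W p q)⁻¹ * (1 - 24 * tateS 1 q) - V.b₂) / 12 * ((x : ℚ_[p]))⁻¹) +
        (padicLog p ((x.num : ℚ) : ℚ_[p]) - ((p : ℚ_[p]) - 1)⁻¹ * ((SL : ℚ_[p]) / (L : ℚ_[p]))) -
        (((uniformisationScaleSq W p q)⁻¹ * (1 - 24 * tateS 1 q) - V.b₂) / 12 - κt) * ((x : ℚ_[p]))⁻¹ := by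
      rw [hTdef]; ring
    rw [e1]
    refine (norm_sub_le_max₃ _ _).trans (max_le ((norm_add_le_max _ _).trans (max_le (hlaw.trans_eq h4k) ?_)) ?_)
    · rw [hnum, Rat.cast_intCast]; exact hloga'
    · rw [norm_mul, norm_inv, hxinv]
      calc ‖((uniformisationScaleSq W p q)⁻¹ * (1 - 24 * tateS 1 q) - V.b₂) / 12 - κt‖ * (p : ℝ) ^ (-((2 * k : ℕ) : ℤ))
          ≤ (p : ℝ) ^ (-((2 * k + v : ℕ) : ℤ)) * (p : ℝ) ^ (-((2 * k : ℕ) : ℤ)) := by gcongr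
        _ = (p : ℝ) ^ (-((2 * k + v : ℕ) : ℤ) + -((2 * k : ℕ) : ℤ)) := by rw [zpow_add₀ hpR0.ne']
        _ ≤ (p : ℝ) ^ (-((4 * k : ℕ) : ℤ)) := zpow_le_zpow_right₀ hp1' (by push_cast; omega)
  -- (G) the split assembly (part 11b)
  have hcore := norm_heightSplitCoord_sub_certTs_le_padic hp5 W h hx1 hxinv hk hb2n hVc4n hT hCct hctn hLq hLl hv2k
  rw [← hVdef] at hcore
  set P3 : ℚ_[p] := ((x : ℚ_[p]))⁻¹ - V.b₂ / 12 * ((x : ℚ_[p]))⁻¹ ^ 2 +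
    (V.b₂ ^ 2 / 144 + V.c₄ / 240) * ((x : ℚ_[p]))⁻¹ ^ 3 with hP3def
  set Ts : ℚ_[p] := T - ct * P3 / lg with hTsdef
  -- (H) `Ts · Den = Ms` and the conclusion
  have hDenn : ‖(Den : ℚ_[p])‖ = (p : ℝ) ^ (-(d : ℤ)) := GaloisImage.PadicSquareClass.norm_intCast_padic_eq hdD hdD'
  have hDen0 : (Den : ℚ_[p]) ≠ 0 := norm_pos_iff.mp (by rw [hDenn]; positivity)
  have hSB0 : (SB : ℚ_[p]) ≠ 0 := by
    intro h0; apply hDen0; rw [hDen]; push_cast; rw [h0]; ring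
  have hLB0 : (LB : ℚ_[p]) ≠ 0 := by
    intro h0; apply hSB0
    have hc := congrArg (fun t : ℚ => (t : ℚ_[p])) hSB
    simp only [Rat.cast_mul, Rat.cast_intCast] at hc
    rw [hc, h0, zero_mul]
  have hTsM : Ts * (Den : ℚ_[p]) = (Ms : ℚ_[p]) := by
    rw [hTsdef, hTdef, hκtdef, hctdef, hP3def, hlgdef, hDen, hMs, hxp, hVb2, hVc4, hVc6, hedef]; push_cast
    rw [Nat.cast_sub hpP.one_le, Nat.cast_one]
    field_simp
    ring
  have hTsn : ‖Ts‖ = ‖(Ms : ℚ_[p])‖ * (p : ℝ) ^ (d : ℤ) := by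
    have eT : Ts = (Ms : ℚ_[p]) / (Den : ℚ_[p]) := by rw [← hTsM, mul_div_cancel_right₀ _ hDen0]
    rw [eT, norm_div, hDenn, zpow_neg, div_inv_eq_mul]
  have hMgt : (p : ℝ) ^ (-((4 * k + d : ℕ) : ℤ)) < ‖(Ms : ℚ_[p])‖ := by
    by_contra hle
    exact hcrit ((Padic.norm_int_le_pow_iff_dvd Ms (4 * k + d)).mp (not_lt.mp hle))
  have hTgt : (p : ℝ) ^ (-((4 * k : ℕ) : ℤ)) < ‖Ts‖ := by
    rw [hTsn]
    calc (p : ℝ) ^ (-((4 * k : ℕ) : ℤ)) = (p : ℝ) ^ (-((4 * k + d : ℕ) : ℤ)) * (p : ℝ) ^ (d : ℤ) := by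
          rw [← zpow_add₀ hpR0.ne']; congr 1; push_cast; ring
      _ < ‖(Ms : ℚ_[p])‖ * (p : ℝ) ^ (d : ℤ) := by gcongr
  intro h0
  rw [h0, zero_sub, norm_neg] at hcore
  exact absurd hcore (not_le.mpr hTgt)

end CertSplitChecker

end Summit.BirchSwinnertonDyer.Rank1Residual.X11b.RegMult.HeightLogNumerator

end
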